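import Summits.CriticalPhenomena.PercolationContinuityZ3.Theorems.PercNearOneGluingNoHeavyQuantSymTriple
import HarnessLib

/-!
# QUANT lane R8, T-DEC: THE SYMMETRIC TRIPLE AT ITS TRUE FLOOR — three identical composite siblings with root gate `q ≤ 1/2` are SDEC
# given the oracle, with NO slack: `t∗t∗t = (1−q)·[t_q ∗ t_{2q}] + q(1−q)·[gate_{2q}(ρ ∗ gate_{1/2} ρ)] + q²·gate_q(ρ∗ρ∗ρ)`
# (arm-1 gen 53, architect)

builds on p205010 (kernel theorem, internal audit signed; external expert review pending)

Support file (`--supports stmt-CriticalPhenomena-4575`), QUANT lane seat prim-quant-arm-1 (gen 53, architect); memo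
`run/shared/lean/prim/quant/prim-quant-arm-1-g53/ARCH-G53.md` §2c.  Theorems only, standard axioms, no sorries.  Sequel of ✓ `…QuantSymTriple`
(the slack certificates AC / EF and the generating-polynomial tools `lawPoly_lin`, `eq_of_lawPoly_eq`, `lawPoly_flaw_three`, `ftop_three`).

THE CERTIFICATE.  For three copies of a tree-built composite sibling `t` (root gate `q`, opened sub-forest `ρ` at floor `x₁`, mean `m`) with
`2q ≤ 1`, the forest law is the EXACT three-component mixture
  `t∗t∗t = (1−q)·[gate_q ρ ∗ gate_{2q} ρ] + q(1−q)·[gate_{2q}(ρ ∗ gate_{1/2} ρ)] + q²·[gate_q(ρ∗ρ∗ρ)]`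
(`flaw_symTriple_eq_mixZ`; the open-block counts `B(q)+B(2q)`, `B(2q)(1+B(½))`, `3B(q)` mix with weights `(1−q, q(1−q), q²)` to `Bin(3,q)`):
two siblings with the third ABSENT and the second root gate DOUBLED; the doubled sibling with the second block hung under its root at edge `½`;
and the merged triple.  Every component is tree-built with fewer than `fgates [t,t,t] = 3(t.n+1)` nontrivial gates AT THE FOREST'S OWN FLOOR
`q·x₁` (effective opennesses `q, 2q`; `2q, 2q·½ = q`; `q, q, q`) and has mean exactly `3qm`, so each `gate_a` of it is DEC at the common target
`a·3qm` by ONE oracle call (`decAtT_gate_of_sdec`), and **`sdec_symTriple_trueFloor`**: `Sib.TreeOK x t`, `2·t.q ≤ 1`, the oracle below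
`fgates [t,t,t]` ⟹ `SDEC x (ftop [t,t,t]) (flaw [t,t,t])` — NO further hypothesis.  With `…QuantSymTriple`: the symmetric triple is SDEC given the
oracle at its true floor for `q ≤ 1/2` and at floors `x ≤ e₂e₃·x₁` for `q > 1/2`; at the true floor with `q > 1/2` no common-target mixture of
root-level arrangements of the three blocks exists (memo §2c: every generator has `P(3 open) ≤ (q/(1−q))²·P(0 open)` while `Bin(3,q)` has ratio
`(q/(1−q))³`).

HONEST STATUS.  The symmetric triple with `q > 1/2` AT ITS TRUE FLOOR, general (non-identical) triples without a heavy sibling, `SiblingStep`, `GateStepN`,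
`LightResidDECOracle`, `FarTreeRow` remain OPEN; RATE class (log\*) / honest sentence of `run/shared/lean/prim/quant/README.md` unchanged.  [this work].
Nothing here is cited as a published result.  The gluing rows served [cite: KozmaNitzan2024, Conjecture 3 (p. 15)]; product measure
[cite: Grimmett1999, §1.3 p. 10].
-/

noncomputable section

open scoped BigOperators
open Polynomial

namespace Summit.CriticalPhenomena.PercolationContinuityZ3.Theorems
namespace Quant
namespace LawDec

open Finset

/-- **THE TRUE-FLOOR IDENTITY**: with `2e = 1`,
`t∗t∗t = (1−q)·[gate_q ρ ∗ gate_{2q} ρ] + q·((1−q)·[gate_{2q}(ρ ∗ gate_e ρ)] + q·[gate_q(ρ∗ρ∗ρ)])`. [this work] -/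
theorem flaw_symTriple_eq_mixZ (t : Sib) (e : ℝ) (he : 2 * e = 1) :
    flaw [t, t, t] = fun h => (1 - t.q) * lconv t.M t.M (gate t.ρ t.q) (gate t.ρ (2 * t.q)) h
      + (1 - (1 - t.q)) * ((1 - t.q) * gate (lconv t.M t.M t.ρ (gate t.ρ e)) (2 * t.q) h
        + (1 - (1 - t.q)) * gate (lconv (t.M + t.M) t.M (lconv t.M t.M t.ρ t.ρ) t.ρ) t.q h) := by
  apply eq_of_lawPoly_eq (t.M + t.M + t.M)
  · intro h hh; exact flaw_eq_zero_of_lt [t, t, t] h (by rw [ftop_three]; exact hh)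
  · intro h hh
    rw [lconv_eq_zero _ _ _ _ h (by omega), gate_eq_zero_above _ _ _ (fun k hk => lconv_eq_zero _ _ _ _ k hk) h (by omega),
      gate_eq_zero_above _ _ _ (fun k hk => lconv_eq_zero _ _ _ _ k hk) h hh]
    ring
  rw [lawPoly_flaw_three, lawPoly_lin, lawPoly_lin,
    lawPoly_top_of_le (t.M + t.M) (t.M + t.M + t.M) _ (by omega) (fun k hk => lconv_eq_zero _ _ _ _ k hk),
    lawPoly_top_of_le (t.M + t.M) (t.M + t.M + t.M) (gate (lconv t.M t.M t.ρ (gate t.ρ e)) (2 * t.q)) (by omega)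
      (fun k hk => gate_eq_zero_above _ _ _ (fun k' hk' => lconv_eq_zero _ _ _ _ k' hk') k hk),
    lawPoly_lconv, lawPoly_gate, lawPoly_gate, lawPoly_gate, lawPoly_lconv, lawPoly_gate, lawPoly_gate, lawPoly_lconv, lawPoly_lconv]
  simp only [map_mul, map_sub, map_one, map_ofNat]
  set P : ℝ[X] := lawPoly t.M t.ρ
  have heP := congrArg Polynomial.C he
  simp only [map_mul, map_one, map_ofNat] at heP
  linear_combination (-(C t.q) ^ 2 * (1 - C t.q) * (P ^ 2 - P)) * heP

/-- **THE SYMMETRIC TRIPLE IS SDEC AT ITS TRUE FLOOR (`q ≤ 1/2`).**  Floor `0 < x < 1`, a tree-built composite sibling `t` with `2·t.q ≤ 1`, the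
oracle "every tree-built law with fewer than `fgates [t,t,t]` nontrivial gates is SDEC" ⟹ `SDEC x (ftop [t,t,t]) (flaw [t,t,t])`. [this work] -/
theorem sdec_symTriple_trueFloor {x : ℝ} (hx0 : 0 < x) (hx1 : x < 1) (t : Sib) (ht : t.TreeOK x) (hq2 : 2 * t.q ≤ 1)
    (hO : ∀ (x' : ℝ) (n' M' : ℕ) (μ' : ℕ → ℝ), n' < fgates [t, t, t] → TreeBuiltN x' n' M' μ' → SDEC x' M' μ') :
    SDEC x (ftop [t, t, t]) (flaw [t, t, t]) := by
  intro a ha0 ha1 j hj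
  obtain ⟨hq0, hq1, hxq, hT, _⟩ := ht
  obtain ⟨hx₁0, hx₁1, ρ0, ρM, ρ1, ρta⟩ := hT.lawFacts
  have hfg : fgates [t, t, t] = 3 * t.n + 3 := by simp only [fgates]; omega
  set z : ℝ := a * x with hzdef
  have hz0 : 0 < z := mul_pos ha0 hx0
  have hz1 : z < 1 := by rw [hzdef]; exact mul_lt_one_aux ha1 hx0.le hx1
  set m : ℝ := t.mean with hmdef
  have hmean : ∑ h ∈ Finset.range (t.M + 1), (h : ℝ) * t.ρ h = m := rfl
  have h2q0 : 0 < 2 * t.q := by linarith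
  -- the common floor `q·x₁` of the three components and the gate hypothesis
  have hy0 : 0 < t.q * t.x₁ := by positivity
  have hy1 : t.q * t.x₁ < 1 := mul_lt_one_aux hq1.le hx₁0.le hx₁1
  have hzy : z ≤ a * (t.q * t.x₁) := by rw [hzdef]; exact mul_le_mul_of_nonneg_left hxq ha0.le
  have hay : a * (t.q * t.x₁) < 1 := mul_lt_one_aux ha1 hy0.le hy1
  -- component Z₁: `gate_q ρ ∗ gate_{2q} ρ` (third sibling absent), floor `q x₁`, `≤ 2 t.n + 2` gates
  have hG₁ : TreeBuiltN (t.q * t.x₁) (t.n + 1) t.M (gate t.ρ t.q) := TreeBuiltN.gate t.q hq0 hq1 hT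
  obtain ⟨n₂, hn₂, hG₂⟩ := treeBuiltN_gate_le (t.q * t.x₁) (2 * t.q) t.n t.M t.ρ h2q0 hq2
    (TreeBuiltN.mono hT (by positivity) (by rw [div_le_iff₀ h2q0]; nlinarith))
  have hZ₁ : TreeBuiltN (t.q * t.x₁) (t.n + 1 + n₂) (t.M + t.M) (lconv t.M t.M (gate t.ρ t.q) (gate t.ρ (2 * t.q))) :=
    TreeBuiltN.conv hG₁ hG₂
  have hS₁ := hO _ _ _ _ (by rw [hfg]; omega) hZ₁
  obtain ⟨_, _, Z0, ZM, Z1, Zta⟩ := hZ₁.lawFacts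
  obtain ⟨a0, aM, a1⟩ := gate_laws t.M t.ρ t.q hq0.le hq1.le ρ0 ρM ρ1
  obtain ⟨b0, bM, b1⟩ := gate_laws t.M t.ρ (2 * t.q) h2q0.le hq2 ρ0 ρM ρ1
  have hZ₁mean : ∑ h ∈ Finset.range (t.M + t.M + 1), (h : ℝ) * lconv t.M t.M (gate t.ρ t.q) (gate t.ρ (2 * t.q)) h = t.q * (3 * m) := by
    rw [sum_mul_lconv _ _ _ _ a1 b1, sum_mul_gate, sum_mul_gate, hmean]; ring
  have d₁ : DECAtT z (a * (t.q * (3 * m))) j (t.M + t.M + t.M) (gate (lconv t.M t.M (gate t.ρ t.q) (gate t.ρ (2 * t.q))) a) := by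
    have := decAtT_gate_of_sdec (t.M + t.M) _ (t.q * t.x₁) a z hy0.le ha0 ha1 hay hzy Z0 ZM Z1 Zta hS₁ j
    rw [hZ₁mean] at this
    exact decAtT_mono_top this (by omega)
  -- component Z₃: `gate_{2q}(ρ ∗ gate_{1/2} ρ)` (the doubled sibling with the second block hung at edge `1/2`), floor `q x₁`, `2 t.n + 2` gates
  have hhalf0 : (0 : ℝ) < 1 / 2 := by norm_num
  have hhalf1 : (1 : ℝ) / 2 < 1 := by norm_num
  have hE : TreeBuiltN (1 / 2 * t.x₁) (t.n + 1) t.M (gate t.ρ (1 / 2)) := TreeBuiltN.gate (1 / 2) hhalf0 hhalf1 hT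
  have hI : TreeBuiltN (1 / 2 * t.x₁) (t.n + (t.n + 1)) (t.M + t.M) (lconv t.M t.M t.ρ (gate t.ρ (1 / 2))) :=
    TreeBuiltN.conv (TreeBuiltN.mono hT (by positivity) (by nlinarith)) hE
  obtain ⟨n₃, hn₃, hZ₃⟩ := treeBuiltN_gate_le (t.q * t.x₁) (2 * t.q) (t.n + (t.n + 1)) (t.M + t.M) _ h2q0 hq2
    (by rw [show t.q * t.x₁ / (2 * t.q) = 1 / 2 * t.x₁ by field_simp]; exact hI)
  have hS₃ := hO _ _ _ _ (by rw [hfg]; omega) hZ₃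
  obtain ⟨_, _, W0, WM, W1, Wta⟩ := hZ₃.lawFacts
  obtain ⟨e0, eM, e1⟩ := gate_laws t.M t.ρ (1 / 2) hhalf0.le hhalf1.le ρ0 ρM ρ1
  have hZ₃mean : ∑ h ∈ Finset.range (t.M + t.M + 1), (h : ℝ) * gate (lconv t.M t.M t.ρ (gate t.ρ (1 / 2))) (2 * t.q) h = t.q * (3 * m) := by
    rw [sum_mul_gate, sum_mul_lconv _ _ _ _ ρ1 e1, sum_mul_gate, hmean]; ring
  have d₃ : DECAtT z (a * (t.q * (3 * m))) j (t.M + t.M + t.M) (gate (gate (lconv t.M t.M t.ρ (gate t.ρ (1 / 2))) (2 * t.q)) a) := by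
    have := decAtT_gate_of_sdec (t.M + t.M) _ (t.q * t.x₁) a z hy0.le ha0 ha1 hay hzy W0 WM W1 Wta hS₃ j
    rw [hZ₃mean] at this
    exact decAtT_mono_top this (by omega)
  -- component A: the merged triple `gate_q(ρ∗ρ∗ρ)`, floor `q x₁`, `3 t.n + 1` gates
  have hA3 : TreeBuiltN t.x₁ (t.n + t.n + t.n) (t.M + t.M + t.M) (lconv (t.M + t.M) t.M (lconv t.M t.M t.ρ t.ρ) t.ρ) :=
    TreeBuiltN.conv (TreeBuiltN.conv hT hT) hT
  have hA : TreeBuiltN (t.q * t.x₁) (t.n + t.n + t.n + 1) (t.M + t.M + t.M)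
      (gate (lconv (t.M + t.M) t.M (lconv t.M t.M t.ρ t.ρ) t.ρ) t.q) := TreeBuiltN.gate t.q hq0 hq1 hA3
  have hSA := hO _ _ _ _ (by rw [hfg]; omega) hA
  obtain ⟨_, _, A0, AM, A1, Ata⟩ := hA.lawFacts
  have hAmean : ∑ h ∈ Finset.range (t.M + t.M + t.M + 1), (h : ℝ) * gate (lconv (t.M + t.M) t.M (lconv t.M t.M t.ρ t.ρ) t.ρ) t.q h
      = t.q * (3 * m) := by
    rw [sum_mul_gate, sum_mul_lconv _ _ _ _ (sum_lconv _ _ _ _ ρ1 ρ1) ρ1, sum_mul_lconv _ _ _ _ ρ1 ρ1, hmean]; ring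
  have dA : DECAtT z (a * (t.q * (3 * m))) j (t.M + t.M + t.M)
      (gate (gate (lconv (t.M + t.M) t.M (lconv t.M t.M t.ρ t.ρ) t.ρ) t.q) a) := by
    have := decAtT_gate_of_sdec (t.M + t.M + t.M) _ (t.q * t.x₁) a z hy0.le ha0 ha1 hay hzy A0 AM A1 Ata hSA j
    rwa [hAmean] at this
  -- the mixture `(1−q)·Z₁ + q·((1−q)·Z₃ + q·A)`
  have hp0 : 0 ≤ 1 - t.q := by linarith
  have hp1 : 1 - t.q ≤ 1 := by linarith
  have inner := decAtT_mixture (1 - t.q) hp0 hp1 d₃ dA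
  have mix := decAtT_mixture (1 - t.q) hp0 hp1 d₁ inner
  have eF := flaw_symTriple_eq_mixZ t (1 / 2) (by norm_num)
  have e : gate (flaw [t, t, t]) a = fun h => (1 - t.q) * gate (lconv t.M t.M (gate t.ρ t.q) (gate t.ρ (2 * t.q))) a h
      + (1 - (1 - t.q)) * ((1 - t.q) * gate (gate (lconv t.M t.M t.ρ (gate t.ρ (1 / 2))) (2 * t.q)) a h
        + (1 - (1 - t.q)) * gate (gate (lconv (t.M + t.M) t.M (lconv t.M t.M t.ρ t.ρ) t.ρ) t.q) a h) := by
    funext h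
    rw [eF]
    simp only [gate_apply]
    ring
  have hL : ∀ s ∈ [t, t, t], s.LawOK := by
    intro s hs; simp only [List.mem_cons, List.mem_nil_iff, or_false, or_self] at hs; subst hs; exact ⟨hq0, hq1, ρ0, ρM, ρ1⟩
  obtain ⟨_, _, _, tmn⟩ := flaw_facts [t, t, t] hL
  have hEmean : ∑ h ∈ Finset.range (ftop [t, t, t] + 1), (h : ℝ) * gate (flaw [t, t, t]) a h = a * (t.q * (3 * m)) := by
    rw [sum_mul_gate, tmn]; simp only [fmean]; rw [hmdef]; ring
  rw [decAt_iff_decAtT, hEmean, e, ftop_three]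
  exact mix

end LawDec
end Quant
end Summit.CriticalPhenomena.PercolationContinuityZ3.Theorems
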